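import Summits.Ventures.LatticeQCDFlow.Scoring.SpecialUnitaryLaplaceBound
import Summits.Ventures.LatticeQCDFlow.Scoring.BesselToeplitzLaplace
import Summits.Ventures.LatticeQCDFlow.Scoring.SUNOnePlaquetteBesselSeries
import HarnessLib

/-!
# Laplace's method on the `SU(N)` torus — THE WEAK-COUPLING LAW OF THE `SU(N)` ONE-PLAQUETTE PARTITION FUNCTION FOR EVERY `N`: `Σ_{q∈ℤ} det[I_{|q+i−j|}(x)]_{N×N} · e^{−Nx} · √x^{N²−1} → M^{SU}_N / ((2π)^{N−1} N!)`

HONEST FRAMING: exact (Metropolis-corrected) sampling algorithms for lattice gauge theory;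
figures of merit are autocorrelation/cost numbers at stated couplings and volumes; no
continuum-physics claim.

Venture `LatticeQCDFlow` (cell pub-lqcd), sub-topic `Scoring`; FANOUT row 5 (`s0-sun-a`), GEN-20.
NEW WORK of the cell (placement rule).  GEN-17's `SUNTorusBesselSeries` / `SUNOnePlaquetteBesselSeries` typed the
`SU(N)` one-plaquette partition function in the free eigen-phases `θ : {i ≠ i₀} → (−π,π]`, `φ_{i₀} = −Σθ`:
`∫ e^{xΣ_b cos φ_b} Π_{j≺k}|e^{iφ_j} − e^{iφ_k}|² dθ = (2π)^{N−1} N! Σ_{q∈ℤ} det[I_{|i−j−q|}(x)] = (2π)^{N−1} N! ∫_{SU(N)} e^{x Re tr U} dU`.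
Here, exactly as GEN-20's `BesselToeplitzLaplace` did for `U(N)`: substitute `θ = ψ/√x`, dominate, and let `x → ∞`.
The rank of `SU(N)` is `N − 1` and there are `N(N−1)/2` root pairs, whence the power `x^{−(N²−1)/2} = x^{−dim SU(N)/2}`:

* (part I, `SpecialUnitaryLaplaceBound`: the phases `φ_b(ψ)`, the bound `mul_prod_le_suBound`, `integrable_suBound`);
* §2 **`integral_suScaledIntegrand_eq`** (change of variables on `ℝ^{N−1}`), `suScaledIntegrand_le_bound`,
  `tendsto_suScaledIntegrand`, **`tendsto_integral_suScaledIntegrand`** (dominated convergence), **`suGaussVandermonde_pos`**;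
* §3 **`tendsto_tsum_det_besselI_enum_weakCoupling`** (any finite index type with a marked `i₀`) and
  **`tendsto_tsum_det_besselI_weakCoupling`**: for every `N ≥ 1`, as `x → ∞`,
  `Σ_q det[I_{|q+i−j|}(x)]_{i,j<N} · e^{−Nx} · x^{|OD|} · √x^{N−1} → M^{SU}_N / ((2π)^{N−1} N!)` with
  `M^{SU}_N = ∫_{ℝ^{N−1}} e^{−Σ_b φ_b(ψ)²/2} Π_{j≺k}(φ_j(ψ) − φ_k(ψ))² dψ > 0`, `x^{|OD|} √x^{N−1} = √x^{N²−1}`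
  (`card_ne_add_two_mul_card_OD`).

NOT CLAIMED: the closed form `M^{SU}_N = √(2π)^{N−1} sf(N)/√N` (a linear change of variables from Mehta's integral;
`-- TODO(general form)`); the sibling `SUNFreeEnergyWeakCoupling2D` turns this law into
`f_{SU(N)}(β) + ((N²−1)/2) log β → log(M^{SU}_N/((2π)^{N−1} N!))`.  No `def`, nothing cited as a fact, 0 sorry.
-/

noncomputable section

open Real MeasureTheory Filter Topology Finset
open Complex (I)
open Literature.Analysis.FunctionSpaces (besselI)
open Literature.RepresentationTheory.CompactGroups.WeylIntegration (OD enum)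

namespace Summit.Ventures.LatticeQCDFlow.Scoring

section SU

variable {n : Type*} [Fintype n] [DecidableEq n] (i₀ : n)

/-! ### 2. Change of variables and dominated convergence on `ℝ^{N−1}` -/

/-- **Change of variables `θ = ψ/√x` on `ℝ^{N−1}`**: for `x > 0`,
`∫_{ℝ^{N−1}} 1[ψ/√x ∈ (−π,π]^{N−1}] e^{Σ_b x(cos(φ_b(ψ)/√x)−1)} Π_{j≺k} 2x(1−cos((φ_j(ψ)−φ_k(ψ))/√x)) dψ
 = e^{−Nx} x^{|OD|} √x^{N−1} ∫_{(−π,π]^{N−1}} e^{xΣ_b cos φ_b(θ)} Π|e^{iφ_j(θ)} − e^{iφ_k(θ)}|² dθ`. -/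
theorem integral_suScaledIntegrand_eq {x : ℝ} (hx : 0 < x) :
    ∫ ψ : {i : n // i ≠ i₀} → ℝ, ((fun ψ : {i : n // i ≠ i₀} → ℝ => fun k => ψ k / √x) ⁻¹'
        Set.univ.pi fun _ => Set.Ioc (-π) π).indicator
        (fun ψ => Real.exp (∑ b, x * (Real.cos ((if h : b = i₀ then -∑ k, ψ k else ψ ⟨b, h⟩) / √x) - 1)) *
          ∏ p : OD n, (2 * x * (1 - Real.cos (((if h : p.1.1 = i₀ then -∑ k, ψ k else ψ ⟨p.1.1, h⟩) -
            (if h : p.1.2 = i₀ then -∑ k, ψ k else ψ ⟨p.1.2, h⟩)) / √x)))) ψ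
      = Real.exp (-(Fintype.card n * x)) * x ^ Fintype.card (OD n) * √x ^ Fintype.card {i : n // i ≠ i₀} *
        ∫ θ, Real.exp (x * ∑ b, Real.cos (if h : b = i₀ then -∑ k, θ k else θ ⟨b, h⟩)) *
            ∏ p : OD n, ‖Complex.exp (((if h : p.1.1 = i₀ then -∑ k, θ k else θ ⟨p.1.1, h⟩ : ℝ) : ℂ) * I) -
              Complex.exp (((if h : p.1.2 = i₀ then -∑ k, θ k else θ ⟨p.1.2, h⟩ : ℝ) : ℂ) * I)‖ ^ 2
          ∂(Measure.pi fun _ : {i : n // i ≠ i₀} => (volume : Measure ℝ).restrict (Set.Ioc (-π) π)) := by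
  have hsx : 0 < √x := Real.sqrt_pos.2 hx
  set c : ℝ := (√x)⁻¹ with hc
  -- the torus integral as an integral over `ℝ^{N−1}` of an indicator, in real-trigonometric form
  set F : ({i : n // i ≠ i₀} → ℝ) → ℝ := fun θ => Real.exp (x * ∑ b, Real.cos (if h : b = i₀ then -∑ k, θ k else θ ⟨b, h⟩)) *
    ∏ p : OD n, (2 - 2 * Real.cos ((if h : p.1.1 = i₀ then -∑ k, θ k else θ ⟨p.1.1, h⟩) -
      (if h : p.1.2 = i₀ then -∑ k, θ k else θ ⟨p.1.2, h⟩))) with hF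
  set cube : Set ({i : n // i ≠ i₀} → ℝ) := Set.univ.pi fun _ => Set.Ioc (-π) π with hcube
  have hcube_meas : MeasurableSet cube := MeasurableSet.univ_pi fun _ => measurableSet_Ioc
  have htorus : ∫ θ, Real.exp (x * ∑ b, Real.cos (if h : b = i₀ then -∑ k, θ k else θ ⟨b, h⟩)) *
        ∏ p : OD n, ‖Complex.exp (((if h : p.1.1 = i₀ then -∑ k, θ k else θ ⟨p.1.1, h⟩ : ℝ) : ℂ) * I) -
          Complex.exp (((if h : p.1.2 = i₀ then -∑ k, θ k else θ ⟨p.1.2, h⟩ : ℝ) : ℂ) * I)‖ ^ 2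
        ∂(Measure.pi fun _ : {i : n // i ≠ i₀} => (volume : Measure ℝ).restrict (Set.Ioc (-π) π))
      = ∫ θ : {i : n // i ≠ i₀} → ℝ, cube.indicator F θ := by
    simp_rw [norm_cexp_sub_cexp_sq]
    rw [← Measure.restrict_pi_pi, ← volume_pi, integral_indicator hcube_meas]
  have hscale : ∀ ψ : {i : n // i ≠ i₀} → ℝ, (fun k => ψ k / √x) = c • ψ := by
    intro ψ; funext k; simp [hc, div_eq_inv_mul]
  -- the scaled integrand is `e^{−Nx} x^{|OD|}` times the torus integrand at `c • ψ`
  have hind : ∀ ψ : {i : n // i ≠ i₀} → ℝ,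
      ((fun ψ : {i : n // i ≠ i₀} → ℝ => fun k => ψ k / √x) ⁻¹' cube).indicator
        (fun ψ => Real.exp (∑ b, x * (Real.cos ((if h : b = i₀ then -∑ k, ψ k else ψ ⟨b, h⟩) / √x) - 1)) *
          ∏ p : OD n, (2 * x * (1 - Real.cos (((if h : p.1.1 = i₀ then -∑ k, ψ k else ψ ⟨p.1.1, h⟩) -
            (if h : p.1.2 = i₀ then -∑ k, ψ k else ψ ⟨p.1.2, h⟩)) / √x)))) ψ
      = Real.exp (-(Fintype.card n * x)) * x ^ Fintype.card (OD n) * (cube.indicator F) (c • ψ) := by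
    intro ψ
    by_cases hψ : (fun k => ψ k / √x) ∈ cube
    · rw [Set.indicator_of_mem (show ψ ∈ (fun ψ : {i : n // i ≠ i₀} → ℝ => fun k => ψ k / √x) ⁻¹' cube from hψ),
        Set.indicator_of_mem (show c • ψ ∈ cube by rwa [← hscale]),
        scaledIntegrand_eq_mul x (fun b => (if h : b = i₀ then -∑ k, ψ k else ψ ⟨b, h⟩ : ℝ)), hF, ← hscale]
      simp only [phase_div]
    · rw [Set.indicator_of_notMem (show ψ ∉ (fun ψ : {i : n // i ≠ i₀} → ℝ => fun k => ψ k / √x) ⁻¹' cube from hψ),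
        Set.indicator_of_notMem (show c • ψ ∉ cube by rwa [← hscale]), mul_zero]
  simp_rw [hind]
  rw [integral_const_mul, Measure.integral_comp_smul volume (cube.indicator F) c, htorus,
    Module.finrank_fintype_fun_eq_card, smul_eq_mul]
  have hcN : |(c ^ Fintype.card {i : n // i ≠ i₀})⁻¹| = √x ^ Fintype.card {i : n // i ≠ i₀} := by
    rw [hc, inv_pow, inv_inv, abs_of_pos (pow_pos hsx _)]
  rw [hcN]
  ring

/-- Domination on the cube: for `x > 0` and `ψ/√x ∈ (−π,π]^{N−1}` the scaled integrand is at most the bound. -/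
theorem suScaledIntegrand_le_bound {x : ℝ} (hx : 0 < x) {ψ : {i : n // i ≠ i₀} → ℝ}
    (hψ : ∀ k, ψ k / √x ∈ Set.Ioc (-π) π) :
    Real.exp (∑ b, x * (Real.cos ((if h : b = i₀ then -∑ k, ψ k else ψ ⟨b, h⟩) / √x) - 1)) *
        ∏ p : OD n, (2 * x * (1 - Real.cos (((if h : p.1.1 = i₀ then -∑ k, ψ k else ψ ⟨p.1.1, h⟩) -
          (if h : p.1.2 = i₀ then -∑ k, ψ k else ψ ⟨p.1.2, h⟩)) / √x)))
      ≤ (4 * Fintype.card {i : n // i ≠ i₀}) ^ Fintype.card (OD n) *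
        ∏ k : {i : n // i ≠ i₀}, (Real.exp (-(2 / π ^ 2 * ψ k ^ 2)) * (1 + ψ k ^ 2) ^ Fintype.card (OD n)) := by
  refine mul_prod_le_suBound i₀ ψ ?_ (fun p => pairFactor_nonneg hx.le _) fun p => pairFactor_le_sq hx _
  -- split the sum over `n` at `i₀`: the `i₀` term is `≤ 0`, the others are Gaussian-dominated
  rw [Real.exp_sum, prod_eq_mul_prod_subtype i₀]
  have h0 : Real.exp (x * (Real.cos ((if h : i₀ = i₀ then -∑ k, ψ k else ψ ⟨i₀, h⟩) / √x) - 1)) ≤ 1 := by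
    rw [Real.exp_le_one_iff]
    have hc1 := Real.cos_le_one ((if h : i₀ = i₀ then -∑ k, ψ k else ψ ⟨i₀, h⟩) / √x)
    exact mul_nonpos_of_nonneg_of_nonpos hx.le (by linarith)
  have hrest : ∏ k : {i : n // i ≠ i₀}, Real.exp (x * (Real.cos ((if h : (k : n) = i₀ then -∑ k, ψ k else ψ ⟨k, h⟩) / √x) - 1))
      ≤ ∏ k : {i : n // i ≠ i₀}, Real.exp (-(2 / π ^ 2 * ψ k ^ 2)) := by
    refine Finset.prod_le_prod (fun k _ => (Real.exp_pos _).le) fun k _ => ?_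
    rw [dif_neg k.2, Real.exp_le_exp]
    refine mul_cos_div_sqrt_sub_one_le hx ?_
    rw [abs_le]
    exact ⟨(hψ k).1.le, (hψ k).2⟩
  calc _ ≤ 1 * ∏ k : {i : n // i ≠ i₀}, Real.exp (-(2 / π ^ 2 * ψ k ^ 2)) :=
        mul_le_mul h0 hrest (Finset.prod_nonneg fun k _ => (Real.exp_pos _).le) zero_le_one
    _ = _ := one_mul _

/-- Pointwise limit of the scaled integrand on `ℝ^{N−1}`. -/
theorem tendsto_suScaledIntegrand (ψ : {i : n // i ≠ i₀} → ℝ) :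
    Tendsto (fun x : ℝ => ((fun ψ : {i : n // i ≠ i₀} → ℝ => fun k => ψ k / √x) ⁻¹'
        Set.univ.pi fun _ => Set.Ioc (-π) π).indicator
        (fun ψ => Real.exp (∑ b, x * (Real.cos ((if h : b = i₀ then -∑ k, ψ k else ψ ⟨b, h⟩) / √x) - 1)) *
          ∏ p : OD n, (2 * x * (1 - Real.cos (((if h : p.1.1 = i₀ then -∑ k, ψ k else ψ ⟨p.1.1, h⟩) -
            (if h : p.1.2 = i₀ then -∑ k, ψ k else ψ ⟨p.1.2, h⟩)) / √x)))) ψ)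
      atTop (𝓝 (Real.exp (∑ b, -((if h : b = i₀ then -∑ k, ψ k else ψ ⟨b, h⟩) ^ 2 / 2)) *
        ∏ p : OD n, ((if h : p.1.1 = i₀ then -∑ k, ψ k else ψ ⟨p.1.1, h⟩) -
          (if h : p.1.2 = i₀ then -∑ k, ψ k else ψ ⟨p.1.2, h⟩)) ^ 2)) := by
  have hlim : Tendsto (fun x : ℝ =>
      Real.exp (∑ b, x * (Real.cos ((if h : b = i₀ then -∑ k, ψ k else ψ ⟨b, h⟩) / √x) - 1)) *
        ∏ p : OD n, (2 * x * (1 - Real.cos (((if h : p.1.1 = i₀ then -∑ k, ψ k else ψ ⟨p.1.1, h⟩) -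
          (if h : p.1.2 = i₀ then -∑ k, ψ k else ψ ⟨p.1.2, h⟩)) / √x)))) atTop
      (𝓝 (Real.exp (∑ b, -((if h : b = i₀ then -∑ k, ψ k else ψ ⟨b, h⟩) ^ 2 / 2)) *
        ∏ p : OD n, ((if h : p.1.1 = i₀ then -∑ k, ψ k else ψ ⟨p.1.1, h⟩) -
          (if h : p.1.2 = i₀ then -∑ k, ψ k else ψ ⟨p.1.2, h⟩)) ^ 2)) := by
    refine Tendsto.mul ?_ ?_
    · exact (Real.continuous_exp.tendsto _).comp
        (tendsto_finsetSum _ fun b _ => tendsto_mul_cos_div_sqrt_sub_one _)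
    · exact tendsto_finsetProd _ fun p _ => tendsto_pairFactor _ _
  have hmem : ∀ᶠ x : ℝ in atTop, (fun k => ψ k / √x) ∈ Set.univ.pi fun _ : {i : n // i ≠ i₀} => Set.Ioc (-π) π := by
    have hM : ∀ᶠ x : ℝ in atTop, ∀ k, |ψ k| < π * √x := by
      have hsqrt : Tendsto (fun x : ℝ => π * √x) atTop atTop :=
        (Real.tendsto_sqrt_atTop).const_mul_atTop Real.pi_pos
      exact Filter.eventually_all.2 fun k => hsqrt.eventually_gt_atTop _
    filter_upwards [hM, eventually_gt_atTop (0 : ℝ)] with x hx hx0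
    have hs : 0 < √x := Real.sqrt_pos.2 hx0
    intro k _
    have hk := hx k
    rw [abs_lt] at hk
    constructor
    · rw [lt_div_iff₀ hs]; linarith
    · rw [div_le_iff₀ hs]; linarith
  refine hlim.congr' ?_
  filter_upwards [hmem] with x hx
  rw [Set.indicator_of_mem (show ψ ∈ (fun ψ : {i : n // i ≠ i₀} → ℝ => fun k => ψ k / √x) ⁻¹'
    Set.univ.pi fun _ => Set.Ioc (-π) π from hx)]

/-- **Dominated convergence on `ℝ^{N−1}`**: the scaled integrals tend to
`M^{SU} = ∫_{ℝ^{N−1}} e^{−Σ_b φ_b(ψ)²/2} Π_{j≺k}(φ_j(ψ) − φ_k(ψ))² dψ`. -/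
theorem tendsto_integral_suScaledIntegrand :
    Tendsto (fun x : ℝ => ∫ ψ : {i : n // i ≠ i₀} → ℝ, ((fun ψ : {i : n // i ≠ i₀} → ℝ => fun k => ψ k / √x) ⁻¹'
        Set.univ.pi fun _ => Set.Ioc (-π) π).indicator
        (fun ψ => Real.exp (∑ b, x * (Real.cos ((if h : b = i₀ then -∑ k, ψ k else ψ ⟨b, h⟩) / √x) - 1)) *
          ∏ p : OD n, (2 * x * (1 - Real.cos (((if h : p.1.1 = i₀ then -∑ k, ψ k else ψ ⟨p.1.1, h⟩) -
            (if h : p.1.2 = i₀ then -∑ k, ψ k else ψ ⟨p.1.2, h⟩)) / √x)))) ψ)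
      atTop (𝓝 (∫ ψ : {i : n // i ≠ i₀} → ℝ, Real.exp (∑ b, -((if h : b = i₀ then -∑ k, ψ k else ψ ⟨b, h⟩) ^ 2 / 2)) *
        ∏ p : OD n, ((if h : p.1.1 = i₀ then -∑ k, ψ k else ψ ⟨p.1.1, h⟩) -
          (if h : p.1.2 = i₀ then -∑ k, ψ k else ψ ⟨p.1.2, h⟩)) ^ 2)) := by
  refine tendsto_integral_filter_of_dominated_convergence _ ?_ ?_ (integrable_suBound i₀)
    (Eventually.of_forall (tendsto_suScaledIntegrand i₀))
  · filter_upwards [eventually_gt_atTop (0 : ℝ)] with x hx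
    refine AEStronglyMeasurable.indicator ?_ ?_
    · refine Continuous.aestronglyMeasurable ?_
      refine (Real.continuous_exp.comp (continuous_finsetSum _ fun b _ => ?_)).mul
        (continuous_finsetProd _ fun p _ => ?_)
      · exact continuous_const.mul (((Real.continuous_cos.comp
          ((continuous_ext_apply i₀ b).div_const _))).sub continuous_const)
      · exact continuous_const.mul (continuous_const.sub (Real.continuous_cos.comp
          (((continuous_ext_apply i₀ p.1.1).sub (continuous_ext_apply i₀ p.1.2)).div_const _)))
    · exact (MeasurableSet.univ_pi fun _ => measurableSet_Ioc).preimage (by fun_prop)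
  · filter_upwards [eventually_gt_atTop (0 : ℝ)] with x hx
    refine Eventually.of_forall fun ψ => ?_
    rw [Real.norm_eq_abs]
    by_cases hψ : ψ ∈ (fun ψ : {i : n // i ≠ i₀} → ℝ => fun k => ψ k / √x) ⁻¹' Set.univ.pi fun _ => Set.Ioc (-π) π
    · rw [Set.indicator_of_mem hψ, abs_of_nonneg (mul_nonneg (Real.exp_nonneg _)
        (Finset.prod_nonneg fun p _ => pairFactor_nonneg hx.le _))]
      exact suScaledIntegrand_le_bound i₀ hx fun k => hψ k (Set.mem_univ _)
    · rw [Set.indicator_of_notMem hψ, abs_zero]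
      exact mul_nonneg (by positivity) (Finset.prod_nonneg fun b _ => by positivity)

/-- **`M^{SU} > 0`**: the limit integrand is continuous, non-negative and non-zero at the free phases
`ψ_k = enum k + 1` (all phases distinct: the free ones are positive and distinct, `φ_{i₀} = −Σψ` is negative). -/
theorem suGaussVandermonde_pos :
    0 < ∫ ψ : {i : n // i ≠ i₀} → ℝ, Real.exp (∑ b, -((if h : b = i₀ then -∑ k, ψ k else ψ ⟨b, h⟩) ^ 2 / 2)) *
        ∏ p : OD n, ((if h : p.1.1 = i₀ then -∑ k, ψ k else ψ ⟨p.1.1, h⟩) -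
          (if h : p.1.2 = i₀ then -∑ k, ψ k else ψ ⟨p.1.2, h⟩)) ^ 2 := by
  have hcont : Continuous fun ψ : {i : n // i ≠ i₀} → ℝ =>
      Real.exp (∑ b, -((if h : b = i₀ then -∑ k, ψ k else ψ ⟨b, h⟩) ^ 2 / 2)) *
        ∏ p : OD n, ((if h : p.1.1 = i₀ then -∑ k, ψ k else ψ ⟨p.1.1, h⟩) -
          (if h : p.1.2 = i₀ then -∑ k, ψ k else ψ ⟨p.1.2, h⟩)) ^ 2 := by
    refine (Real.continuous_exp.comp (continuous_finsetSum _ fun b _ =>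
      ((continuous_ext_apply i₀ b).pow 2 |>.div_const _).neg)).mul
      (continuous_finsetProd _ fun p _ => ((continuous_ext_apply i₀ p.1.1).sub (continuous_ext_apply i₀ p.1.2)).pow 2)
  have hnn : 0 ≤ fun ψ : {i : n // i ≠ i₀} → ℝ =>
      Real.exp (∑ b, -((if h : b = i₀ then -∑ k, ψ k else ψ ⟨b, h⟩) ^ 2 / 2)) *
        ∏ p : OD n, ((if h : p.1.1 = i₀ then -∑ k, ψ k else ψ ⟨p.1.1, h⟩) -
          (if h : p.1.2 = i₀ then -∑ k, ψ k else ψ ⟨p.1.2, h⟩)) ^ 2 :=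
    fun ψ => mul_nonneg (Real.exp_nonneg _) (Finset.prod_nonneg fun p _ => sq_nonneg _)
  have hint : Integrable (fun ψ : {i : n // i ≠ i₀} → ℝ =>
      Real.exp (∑ b, -((if h : b = i₀ then -∑ k, ψ k else ψ ⟨b, h⟩) ^ 2 / 2)) *
        ∏ p : OD n, ((if h : p.1.1 = i₀ then -∑ k, ψ k else ψ ⟨p.1.1, h⟩) -
          (if h : p.1.2 = i₀ then -∑ k, ψ k else ψ ⟨p.1.2, h⟩)) ^ 2) := by
    refine Integrable.mono' (integrable_suBound i₀) hcont.aestronglyMeasurable (Eventually.of_forall fun ψ => ?_)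
    rw [Real.norm_eq_abs, abs_of_nonneg (hnn ψ)]
    refine mul_prod_le_suBound i₀ ψ ?_ (fun p => sq_nonneg _) fun p => le_rfl
    rw [Real.exp_sum, prod_eq_mul_prod_subtype i₀]
    have h0 : Real.exp (-((if h : i₀ = i₀ then -∑ k, ψ k else ψ ⟨i₀, h⟩) ^ 2 / 2)) ≤ 1 :=
      Real.exp_le_one_iff.2 (neg_nonpos.2 (by positivity))
    have hrest : ∏ k : {i : n // i ≠ i₀}, Real.exp (-((if h : (k : n) = i₀ then -∑ k, ψ k else ψ ⟨k, h⟩) ^ 2 / 2))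
        ≤ ∏ k : {i : n // i ≠ i₀}, Real.exp (-(2 / π ^ 2 * ψ k ^ 2)) := by
      refine Finset.prod_le_prod (fun k _ => (Real.exp_pos _).le) fun k _ => ?_
      rw [dif_neg k.2, Real.exp_le_exp]
      have hπ : 2 / π ^ 2 ≤ 1 / 2 := by
        rw [div_le_div_iff₀ (by positivity) (by norm_num)]
        nlinarith [Real.pi_gt_three]
      nlinarith [sq_nonneg (ψ k)]
    calc _ ≤ 1 * ∏ k : {i : n // i ≠ i₀}, Real.exp (-(2 / π ^ 2 * ψ k ^ 2)) :=
          mul_le_mul h0 hrest (Finset.prod_nonneg fun k _ => (Real.exp_pos _).le) zero_le_one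
      _ = _ := one_mul _
  rw [integral_pos_iff_support_of_nonneg hnn hint]
  refine hcont.isOpen_support.measure_pos volume ⟨fun k => (enum n (k : n) : ℝ) + 1, ?_⟩
  rw [Function.mem_support]
  refine mul_ne_zero (Real.exp_pos _).ne' (Finset.prod_ne_zero_iff.2 fun p _ => pow_ne_zero _ (sub_ne_zero.2 ?_))
  -- all phases are distinct at this point
  have hpos : ∀ (b : n) (hb : b ≠ i₀),
      (0 : ℝ) < (if h : b = i₀ then -∑ k : {i : n // i ≠ i₀}, ((enum n (k : n) : ℝ) + 1) else (enum n b : ℝ) + 1) := by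
    intro b hb; rw [dif_neg hb]; positivity
  have hne := ne_of_lt p.2
  by_cases h1 : p.1.1 = i₀
  · have h2 : p.1.2 ≠ i₀ := fun h => hne (by rw [h1, h])
    have hneg : (if h : p.1.1 = i₀ then -∑ k : {i : n // i ≠ i₀}, ((enum n (k : n) : ℝ) + 1)
        else (enum n p.1.1 : ℝ) + 1) < 0 := by
      rw [dif_pos h1, neg_lt_zero]
      haveI : Nonempty {i : n // i ≠ i₀} := ⟨⟨p.1.2, h2⟩⟩
      exact Finset.sum_pos (fun k _ => by positivity) Finset.univ_nonempty
    exact fun h => by linarith [hpos p.1.2 h2, h.symm ▸ hneg]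
  · by_cases h2 : p.1.2 = i₀
    · have hneg : (if h : p.1.2 = i₀ then -∑ k : {i : n // i ≠ i₀}, ((enum n (k : n) : ℝ) + 1)
          else (enum n p.1.2 : ℝ) + 1) < 0 := by
        rw [dif_pos h2, neg_lt_zero]
        haveI : Nonempty {i : n // i ≠ i₀} := ⟨⟨p.1.1, h1⟩⟩
        exact Finset.sum_pos (fun k _ => by positivity) Finset.univ_nonempty
      exact fun h => by linarith [hpos p.1.1 h1, h ▸ hneg]
    · rw [dif_neg h1, dif_neg h2]
      intro h
      have h' : ((enum n p.1.1 : ℕ) : ℝ) = ((enum n p.1.2 : ℕ) : ℝ) := by linarith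
      exact hne (Fin.ext (by exact_mod_cast h'))

/-! ### 3. The weak-coupling law of the Bars–Green series `Σ_q det[I_{|q+i−j|}(x)]` -/

/-- `(N − 1) + 2|OD n| = N² − 1` with `N − 1 = |{i ≠ i₀}|`. -/
theorem card_ne_add_two_mul_card_OD :
    Fintype.card {i : n // i ≠ i₀} + 2 * Fintype.card (OD n) = Fintype.card n ^ 2 - 1 := by
  have h := card_add_two_mul_card_OD (n := n)
  have hm : Fintype.card {i : n // i ≠ i₀} = Fintype.card n - 1 := by
    simp [Fintype.card_subtype_compl]
  have h1 : 1 ≤ Fintype.card n := Fintype.card_pos_iff.2 ⟨i₀⟩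
  omega

/-- The weak-coupling law for a general finite index type with a marked index `i₀` (`|n| = N ≥ 1`):
`Σ_q det[I_{|i−j−q|}(x)] · e^{−Nx} · √x^{N²−1} → M^{SU} / ((2π)^{N−1} N!)`. -/
theorem tendsto_tsum_det_besselI_enum_weakCoupling :
    Tendsto (fun x : ℝ => (∑' q : ℤ, (Matrix.of fun i j : n =>
        besselI (((enum n i : ℕ) : ℤ) - ((enum n j : ℕ) : ℤ) - q).natAbs x).det) *
        Real.exp (-(Fintype.card n * x)) * √x ^ (Fintype.card n ^ 2 - 1)) atTop
      (𝓝 ((∫ ψ : {i : n // i ≠ i₀} → ℝ, Real.exp (∑ b, -((if h : b = i₀ then -∑ k, ψ k else ψ ⟨b, h⟩) ^ 2 / 2)) *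
        ∏ p : OD n, ((if h : p.1.1 = i₀ then -∑ k, ψ k else ψ ⟨p.1.1, h⟩) -
          (if h : p.1.2 = i₀ then -∑ k, ψ k else ψ ⟨p.1.2, h⟩)) ^ 2) /
        ((2 * π) ^ Fintype.card {i : n // i ≠ i₀} * (Fintype.card n).factorial))) := by
  have hlim := (tendsto_integral_suScaledIntegrand i₀).div_const
    ((2 * π) ^ Fintype.card {i : n // i ≠ i₀} * (Fintype.card n).factorial)
  refine hlim.congr' ?_
  filter_upwards [eventually_gt_atTop (0 : ℝ)] with x hx
  have hK : (0 : ℝ) < (2 * π) ^ Fintype.card {i : n // i ≠ i₀} * (Fintype.card n).factorial := by positivity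
  rw [integral_suScaledIntegrand_eq i₀ hx, integral_cube_exp_mul_sum_cos_mul_prod_norm_sub_sq_ext]
  have hpow : √x ^ (Fintype.card n ^ 2 - 1) = x ^ Fintype.card (OD n) * √x ^ Fintype.card {i : n // i ≠ i₀} := by
    rw [← card_ne_add_two_mul_card_OD i₀, pow_add, pow_mul, Real.sq_sqrt hx.le, mul_comm]
  rw [hpow]
  field_simp

end SU

/-- Reindexing the Bars–Green series from `n` (through `enum n`, shift `−q`) to the canonical `Fin N` form `q + i − j`. -/
theorem tsum_det_besselI_enum_eq_fin (N : ℕ) (x : ℝ) :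
    ∑' q : ℤ, (Matrix.of fun i j : Fin N =>
        besselI (((enum (Fin N) i : ℕ) : ℤ) - ((enum (Fin N) j : ℕ) : ℤ) - q).natAbs x).det
      = ∑' q : ℤ, (Matrix.of fun i j : Fin N => besselI (q + (i : ℤ) - (j : ℤ)).natAbs x).det := by
  rw [← tsum_det_besselI_fin_card, ← (Equiv.neg ℤ).tsum_eq]
  refine tsum_congr fun q => ?_
  rw [Equiv.neg_apply, show (Matrix.of fun i j : Fin N =>
      besselI (((enum (Fin N) i : ℕ) : ℤ) - ((enum (Fin N) j : ℕ) : ℤ) - -q).natAbs x)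
      = (Matrix.of fun i j : Fin (Fintype.card (Fin N)) => besselI (q + (i : ℤ) - (j : ℤ)).natAbs x).submatrix
          (enum (Fin N)) (enum (Fin N)) from by
        ext i j
        simp only [Matrix.submatrix_apply, Matrix.of_apply]
        rw [show (((enum (Fin N) i : ℕ) : ℤ) - ((enum (Fin N) j : ℕ) : ℤ) - -q)
          = q + ((enum (Fin N) i : ℕ) : ℤ) - ((enum (Fin N) j : ℕ) : ℤ) by ring],
    Matrix.det_submatrix_equiv_self]

/-- **THE WEAK-COUPLING LAW OF THE `SU(N)` ONE-PLAQUETTE PARTITION FUNCTION, EVERY `N ≥ 1`** (Laplace's method on the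
`SU(N)` torus): as `x → ∞`,
`Σ_{q∈ℤ} det[I_{|q+i−j|}(x)]_{i,j<N} · e^{−Nx} · √x^{N²−1} → M^{SU}_N / ((2π)^{N−1} · N!)`, with
`M^{SU}_N = ∫_{ℝ^{N−1}} e^{−Σ_bφ_b(ψ)²/2} Π_{j≺k}(φ_j(ψ) − φ_k(ψ))² dψ > 0` (`suGaussVandermonde_pos`, free phases
`k ≠ 0`, `φ_0 = −Σψ`): `Z^{SU(N)}(x) = ∫_{SU(N)} e^{x Re tr U} dU ~ C_N e^{Nx} x^{−(N²−1)/2}`. -/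
theorem tendsto_tsum_det_besselI_weakCoupling (N : ℕ) [NeZero N] :
    Tendsto (fun x : ℝ => (∑' q : ℤ, (Matrix.of fun i j : Fin N => besselI (q + (i : ℤ) - (j : ℤ)).natAbs x).det) *
        Real.exp (-(N * x)) * √x ^ (N ^ 2 - 1)) atTop
      (𝓝 ((∫ ψ : {i : Fin N // i ≠ 0} → ℝ,
          Real.exp (∑ b, -((if h : b = 0 then -∑ k, ψ k else ψ ⟨b, h⟩) ^ 2 / 2)) *
          ∏ p : OD (Fin N), ((if h : p.1.1 = 0 then -∑ k, ψ k else ψ ⟨p.1.1, h⟩) -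
            (if h : p.1.2 = 0 then -∑ k, ψ k else ψ ⟨p.1.2, h⟩)) ^ 2) /
        ((2 * π) ^ (N - 1) * N.factorial))) := by
  have h := tendsto_tsum_det_besselI_enum_weakCoupling (n := Fin N) 0
  have hm : Fintype.card {i : Fin N // i ≠ 0} = N - 1 := by
    simp [Fintype.card_subtype_compl]
  simp only [tsum_det_besselI_enum_eq_fin, Fintype.card_fin, hm] at h
  exact h

-- TODO(general form): `M^{SU}_N = √(2π)^{N−1} sf(N)/√N` (Mehta's integral on the hyperplane `Σφ = 0`), whence
--   `Σ_q det[I_{|q+i−j|}(x)] e^{−Nx} √x^{N²−1} → sf(N−1) / (√N (2π)^{(N−1)/2})`.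

end Summit.Ventures.LatticeQCDFlow.Scoring
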